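import Literature.NumberTheory.Automorphic.GL2LocalSupercuspForm
import Literature.NumberTheory.Automorphic.CuspidalRepGL2Exists
import Literature.NumberTheory.Automorphic.SupercuspidalPlaceNonvanishingCusp
import Literature.NumberTheory.Automorphic.SupercuspTypeCuspidalImage
import Literature.NumberTheory.Automorphic.CuspidalRepDataOfCuspForm
import Literature.NumberTheory.Automorphic.AdelicGroupDataGLnProofs
import Literature.NumberTheory.Automorphic.GLnPlaceSplittingCentralizer
import HarnessLib

/-!
# Cuspidal automorphic representations of `GL₂(𝔸_F)` exist: proof of
# `nonempty_cuspidalAutomorphicRepData_two`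
(Jacquet–Langlands, LNM 114 (1970), §16, p. 503; Gelbart, *Automorphic Forms on Adele Groups*
(1975), §10, (10.13)–(10.16), pp. 151–153, and Thm. 7.11; Arthur–Clozel (1989), Ch. 1, Lemma 2.4)

Sibling proof file of `CuspidalRepGL2Exists`, discharging its named fact
`nonempty_cuspidalAutomorphicRepData_two` (D-0014): for EVERY number field `F`,
`CuspidalAutomorphicRepData 2 F hF` is inhabited.

Gelbart's printed proof of Thm. 7.11 (the Weil representation `λ ↦ π(λ)` and the converse theorem)
is not available in the tree.  The proof given here is the *supercusp-form principle* of
Jacquet–Langlands §16 / Gelbart §10 ((10.13)–(10.16): "if `f_v` is a supercusp form at one finite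
place, `R(Φ_f)` has its range in `L₀²`" and "`M ≠ 0`"), every brick of which is PROVED in the tree,
applied to the explicit local supercusp form `ξ` of `GL2LocalSupercuspForm` (which exists at every
finite place `w` of every number field, with no supercuspidal representation needed):

1. `exists_nhds_integratedOperator_localTestFunction_ne_zero_of_sum_ne_zero` — the non-vanishing
   half of Gelbart p. 153 for a general vector: for `y ∈ Π` fixed by `ι_w(U)` with
   `h = Σ_γ ξ(γ̃) R(ι_w γ̃) y ≠ 0`, `R(Φ_{θ,ξ}) y ≠ 0` for all weights `θ ≥ 0`, `θ(1) > 0`, supported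
   in a small neighbourhood of `1` (`R(Φ_{θ,ξ}) y = mass(U) h + O(mass(U) δ)`, the tree's
   `integratedOperator_localTestFunction_eq_sum` and `norm_localSmoothing_sub_smul_le`).
2. `GLn.toAdelic_mem_quotientSubgroup_iff` — `ι_w(c) ∈ A_G · GL_n(F)` only for `c = 1` (compare
   components at a second finite place), and the tube lemma
   `exists_nhds_forall_conj_toAdelic_not_mem`: a neighbourhood `N` of `1` in `GL_n(𝔸_F)` with
   `N⁻¹ ι_w(C) N ∩ A_G GL_n(F) = ∅` for a compact `C ∌ 1` (`A_G GL_n(F)` is closed,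
   `isClosed_quotientSubgroup_gl_holds`).
3. `exists_separated_open` — an open `S ≠ ∅` in the automorphic quotient, stable under `ι_w(U₂)`
   and disjoint from its translates by `ι_w(c)`, `c ∈ U₁ ∖ U₂`; its indicator `z = 1_S ∈ L²` is
   `ι_w(U₂)`-fixed and `⟨z, Σ_γ ξ(γ̃) R(ι_w γ̃) z⟩ = ξ(1) μ(S) ≠ 0`.
4. `nonempty_cuspidalAutomorphicRepData_two_holds` — `R(Φ_{θ,ξ}) z` is a NON-ZERO element of
   `L²_cusp(GL₂(F) A_G \ GL₂(𝔸_F))` (`integratedOperator_rightRegular_mem_cuspidalSubspace` with the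
   vanishing unipotent averages of `Φ_{θ,ξ}`, `integral_localTestFunction_comp_glUnipotent_eq_zero`
   fed by `GL2LocalSupercuspForm.integral_form_unipotentOfBlock_eq_zero`), hence `L²_cusp ≠ 0` and
   `CuspidalAutomorphicRepData.ofCuspidalSubspaceNeBot` gives the datum.

## References

* H. Jacquet, R. P. Langlands, *Automorphic Forms on GL(2)*, LNM 114 (1970), §16, p. 503
  [JacquetLanglands1970].
* S. Gelbart, *Automorphic Forms on Adele Groups*, Ann. of Math. Studies 83 (1975), §7.B Thm. 7.11
  and §10, (10.13)–(10.16), pp. 151–153 [Gelbart1975].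
* J. Arthur, L. Clozel, *Simple algebras, base change, and the advanced theory of the trace
  formula*, Ann. of Math. Studies 120 (1989), Ch. 1, Lemma 2.4 [ArthurClozel1989].
-/

noncomputable section

open MeasureTheory Measure Set Filter Topology IsDedekindDomain NumberField CompactlySupported
open scoped Pointwise InnerProductSpace MatrixGroups

namespace Literature.NumberTheory.Automorphic

/-! ### 1. Non-vanishing of `R(Φ_{θ,ξ}) y` from `Σ_γ ξ(γ̃) R(ι_v γ̃) y ≠ 0` -/

section Nonvanishing

variable {n : ℕ} {K : Type} [Field K] [NumberField K] {v : HeightOneSpectrum (𝓞 K)}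
  {μ : Measure (AdelicGroupData.gl n K).automorphicQuotient}
  [(AdelicGroupData.gl n K).IsAutomorphicMeasure μ]

attribute [local instance] adelicBorel borelSpace_adelic locallyCompactSpace_adelic
  secondCountableTopology_gl_adelic

variable (W : ContRepresentation.ClosedSubrep ((AdelicGroupData.gl n K).rightRegular μ))

/-- **Non-vanishing of `R(θ^{(v)} ⊗ ξ_v)` on a vector** (Gelbart (1975), §10, pp. 152–153, "`M ≠ 0`";
Jacquet–Langlands (1970), §16, p. 503), the vector form of
`exists_nhds_integratedOperator_localTestFunction_ne_zero`. Let `Π ≤ L²(GL_n(K) A_G \ GL_n(𝔸_K))`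
be a closed subrepresentation, `U ≤ GL_n(K_v)` compact open, `ξ ∈ C_c(GL_n(K_v))` right
`U`-invariant, `T` a finite set of cosets of `U` covering `supp ξ`, and `y ∈ Π` fixed by `ι_v(U)`
with `h = Σ_{γ ∈ T} ξ(γ̃) R(ι_v γ̃) y ≠ 0`.  Then there is a neighbourhood `N` of `1` in
`GL_n(𝔸_K)` such that `R(Φ_{θ,ξ}) y ≠ 0` for every continuous compactly supported weight `θ ≥ 0`
with `θ(1) > 0` supported in `N`.  Proof as printed: `R(Φ_{θ,ξ}) y = Σ_γ ξ(γ̃) R_{U_γ} R(ι_v γ̃) y`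
(`U_γ = γ̃ U γ̃⁻¹`, Hecke calculus) `= mass(U) h + O(mass(U) δ)` (`R_{U_γ}` is `mass(U)` times an
approximate identity on `ι_v(U_γ)`-fixed vectors). [cite: Gelbart1975, §10 pp. 152–153] -/
theorem exists_nhds_integratedOperator_localTestFunction_ne_zero_of_sum_ne_zero
    {U : Subgroup (GL (Fin n) (v.adicCompletion K))}
    (hU : IsCompact (U : Set (GL (Fin n) (v.adicCompletion K))) ∧
      IsOpen (U : Set (GL (Fin n) (v.adicCompletion K))))
    {ξ : GL (Fin n) (v.adicCompletion K) → ℂ} (hξ : Continuous ξ) (hξs : HasCompactSupport ξ)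
    (hξU : ∀ (g : GL (Fin n) (v.adicCompletion K)), ∀ k ∈ U, ξ (g * k) = ξ g)
    {T : Finset (GL (Fin n) (v.adicCompletion K) ⧸ U)}
    (hT : tsupport ξ ⊆ ⋃ γ ∈ T, {x | (x : GL (Fin n) (v.adicCompletion K) ⧸ U) = γ})
    {y : W.toSubmodule} (hy : y ∈ W.fixedVectors (U.map (GLn.toAdelic n K v)))
    (hmain : ∑ γ ∈ T, ξ γ.out • W.toContRep (GLn.toAdelic n K v γ.out) y ≠ 0) :
    ∃ N ∈ 𝓝 (1 : (AdelicGroupData.gl n K).Adelic),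
      ∀ (θ : (AdelicGroupData.gl n K).Adelic → ℝ) (hθ : Continuous θ) (hθs : HasCompactSupport θ),
        0 ≤ θ → 0 < θ 1 → Function.support θ ⊆ N →
        ((AdelicGroupData.gl n K).rightRegular μ).integratedOperator
            ((AdelicGroupData.gl n K).isUnitary_rightRegular μ)
            ((AdelicGroupData.gl n K).isStronglyContinuous_rightRegular_holds μ) (adelicHaar n K)
            (localTestFunctionCc hθ hθs hξ hξs) ((y : W.toSubmodule) : (AdelicGroupData.gl n K).L2 μ)
          ≠ 0 := by
  classical
  haveI : (adelicHaar n K).IsMulRightInvariant := adelicHaar_isMulRightInvariant n K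
  -- the translates `y_γ = R(ι_v γ̃) y` and the vector `h`
  set yγ : (GL (Fin n) (v.adicCompletion K) ⧸ U) → W.toSubmodule :=
    fun γ => W.toContRep (GLn.toAdelic n K v γ.out) y with hyγ
  set h : W.toSubmodule := ∑ γ ∈ T, ξ γ.out • yγ γ with hh
  have hh0 : h ≠ 0 := hmain
  have hh' : 0 < ‖h‖ := norm_pos_iff.2 hh0
  -- constants and the neighbourhood of `1`
  set C : ℝ := ∑ γ ∈ T, ‖ξ γ.out‖ with hC
  have hC0 : 0 ≤ C := Finset.sum_nonneg fun _ _ => norm_nonneg _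
  set δ : ℝ := ‖h‖ / (2 * (C + 1)) with hδ
  have hδ0 : 0 < δ := div_pos hh' (by positivity)
  set N : Set (AdelicGroupData.gl n K).Adelic :=
    ⋂ γ ∈ T, {s | ‖W.toContRep s (yγ γ) - yγ γ‖ < δ} with hN
  have hNo : IsOpen N :=
    isOpen_biInter_finset fun γ _ => isOpen_lt
      ((continuous_toContRep_apply W (yγ γ)).sub continuous_const).norm continuous_const
  have h1N : (1 : (AdelicGroupData.gl n K).Adelic) ∈ N := by
    simp only [hN, Set.mem_iInter, Set.mem_setOf_eq, map_one]
    intro γ _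
    change ‖yγ γ - yγ γ‖ < δ
    rwa [sub_self, norm_zero]
  refine ⟨N, hNo.mem_nhds h1N, fun θ hθ hθs hθ0 hθ1 hθN => ?_⟩
  -- the conjugate levels `U_γ = γ̃ U γ̃⁻¹` and the Hecke calculus
  set Uc : (GL (Fin n) (v.adicCompletion K) ⧸ U) → Subgroup (GL (Fin n) (v.adicCompletion K)) :=
    fun γ => U.comap (MulAut.conj (γ.out)⁻¹).toMonoidHom with hUc
  have hUc' : ∀ γ, IsCompact (Uc γ : Set (GL (Fin n) (v.adicCompletion K))) ∧
      IsOpen (Uc γ : Set (GL (Fin n) (v.adicCompletion K))) := fun γ =>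
    isCompact_isOpen_comap_conj hU _
  have hterm : ∀ γ, W.toContRep (GLn.toAdelic n K v γ.out) (localSmoothing v W θ U y) =
      localSmoothing v W θ (Uc γ) (yγ γ) := by
    intro γ
    have hset : ((γ.out * ·) '' (U : Set (GL (Fin n) (v.adicCompletion K)))) =
        ((· * γ.out) '' (Uc γ : Set (GL (Fin n) (v.adicCompletion K)))) := by
      ext z
      rw [Set.image_mul_left, Set.image_mul_right, Set.mem_preimage, Set.mem_preimage,
        SetLike.mem_coe, SetLike.mem_coe, hUc, mem_comap_conj_iff, inv_inv]
      rw [show γ.out⁻¹ * (z * γ.out⁻¹) * γ.out = γ.out⁻¹ * z by group]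
    rw [toContRep_toAdelic_localSmoothing hθ hθs hU γ.out y, hset,
      ← localSmoothing_toContRep_toAdelic]
  have hop := integratedOperator_localTestFunction_eq_sum W hθ hθs hU hξ hξs hξU hT y
  -- the approximate identity estimate on each term
  have hm0 : 0 < localMass v θ U := localMass_pos hθ hθs hθ0 hθ1 hU
  set m : ℝ := localMass v θ U with hm
  have hmγ : ∀ γ, localMass v θ (Uc γ) = m := fun γ => localMass_comap_conj U _
  have hyfix : ∀ γ, yγ γ ∈ W.fixedVectors ((Uc γ).map (GLn.toAdelic n K v)) := by
    intro γ
    rw [ContRepresentation.ClosedSubrep.mem_fixedVectors]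
    rintro _ ⟨u, hu, rfl⟩
    have hu' : γ.out⁻¹ * u * γ.out ∈ U := by
      have hu'' : u ∈ (U.comap (MulAut.conj (γ.out)⁻¹).toMonoidHom : Subgroup _) := hu
      rwa [mem_comap_conj_iff, inv_inv] at hu''
    have hfix := (ContRepresentation.ClosedSubrep.mem_fixedVectors W _ y).1 hy _ ⟨_, hu', rfl⟩
    have e1 : W.toContRep (GLn.toAdelic n K v u) (yγ γ) =
        W.toContRep (GLn.toAdelic n K v (u * γ.out)) y := by
      simp only [hyγ]
      rw [map_mul, map_mul]
      rfl
    have e2 : u * γ.out = γ.out * (γ.out⁻¹ * u * γ.out) := by group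
    rw [e1, e2, map_mul, map_mul]
    change W.toContRep (GLn.toAdelic n K v γ.out)
      (W.toContRep (GLn.toAdelic n K v (γ.out⁻¹ * u * γ.out)) y) = _
    rw [hfix]
  have herr : ∀ γ ∈ T, ‖localSmoothing v W θ (Uc γ) (yγ γ) - ((m : ℝ) : ℂ) • yγ γ‖ ≤ m * δ := by
    intro γ hγ
    have hb := norm_localSmoothing_sub_smul_le W hθ hθs hθ0 hθ1 (hUc' γ) (hyfix γ) (δ := δ)
      (fun s hs => by
        have hsN := hθN hs
        simp only [hN, Set.mem_iInter, Set.mem_setOf_eq] at hsN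
        exact (hsN γ hγ).le)
    rwa [hmγ γ] at hb
  -- suppose `R(Φ) y = 0` and derive a contradiction
  intro h0
  rw [hop] at h0
  have h0' : ∑ γ ∈ T, ξ γ.out • W.toContRep (GLn.toAdelic n K v γ.out)
      (localSmoothing v W θ U y) = 0 := by exact_mod_cast h0
  simp_rw [hterm] at h0'
  have hdecomp : ∑ γ ∈ T, ξ γ.out • localSmoothing v W θ (Uc γ) (yγ γ) =
      ((m : ℝ) : ℂ) • h + ∑ γ ∈ T, ξ γ.out •
        (localSmoothing v W θ (Uc γ) (yγ γ) - ((m : ℝ) : ℂ) • yγ γ) := by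
    rw [hh, Finset.smul_sum, ← Finset.sum_add_distrib]
    refine Finset.sum_congr rfl fun γ _ => ?_
    rw [smul_sub, smul_comm ((m : ℝ) : ℂ) (ξ γ.out) (yγ γ)]
    abel
  rw [hdecomp] at h0'
  have hE : ‖∑ γ ∈ T, ξ γ.out • (localSmoothing v W θ (Uc γ) (yγ γ) - ((m : ℝ) : ℂ) • yγ γ)‖ ≤
      C * (m * δ) := by
    calc ‖∑ γ ∈ T, ξ γ.out • (localSmoothing v W θ (Uc γ) (yγ γ) - ((m : ℝ) : ℂ) • yγ γ)‖
        ≤ ∑ γ ∈ T, ‖ξ γ.out • (localSmoothing v W θ (Uc γ) (yγ γ) - ((m : ℝ) : ℂ) • yγ γ)‖ :=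
          norm_sum_le _ _
      _ ≤ ∑ γ ∈ T, ‖ξ γ.out‖ * (m * δ) := Finset.sum_le_sum fun γ hγ => by
          rw [norm_smul]
          exact mul_le_mul_of_nonneg_left (herr γ hγ) (norm_nonneg _)
      _ = C * (m * δ) := by rw [Finset.sum_mul]
  have hnorm : ‖((m : ℝ) : ℂ) • h‖ = m * ‖h‖ := by
    rw [norm_smul, Complex.norm_real, Real.norm_of_nonneg hm0.le]
  have heq : ((m : ℝ) : ℂ) • h =
      -∑ γ ∈ T, ξ γ.out • (localSmoothing v W θ (Uc γ) (yγ γ) - ((m : ℝ) : ℂ) • yγ γ) :=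
    eq_neg_of_add_eq_zero_left h0'
  have hle : m * ‖h‖ ≤ C * (m * δ) := by
    rw [← hnorm, heq, norm_neg]
    exact hE
  have hlt : C * (m * δ) < m * ‖h‖ := by
    have hfrac : C / (2 * (C + 1)) < 1 := by
      rw [div_lt_one (by positivity)]
      linarith
    calc C * (m * δ) = m * ‖h‖ * (C / (2 * (C + 1))) := by rw [hδ]; ring
      _ < m * ‖h‖ * 1 := mul_lt_mul_of_pos_left hfrac (mul_pos hm0 hh')
      _ = m * ‖h‖ := mul_one _
  exact absurd hle (not_le.2 hlt)

end Nonvanishing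

/-! ### 2. `ι_w(GL_n(K_w))` meets `A_G · GL_n(K)` trivially; a tube around `ι_w(C)` -/

section Separation

variable (n : ℕ) {K : Type} [Field K] [NumberField K] (w : HeightOneSpectrum (𝓞 K))

/-- **`ι_w(c) ∈ A_G · GL_n(K)` only for `c = 1`.** If `ι_w(c) = a γ` with `a ∈ A_G = ℝ_{>0}`
(positive real scalars at the archimedean places) and `γ ∈ GL_n(K)`, compare the components at a
finite place `v ≠ w` (a number field has infinitely many): `1 = γ` in `GL_n(K_v)`, so `γ = 1`
(`K → K_v` is injective), `ι_w(c) = a`, and at `w`: `c = a_w = 1`. (Weil, *Basic Number Theory*,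
Ch. IV §2: `K` is discrete in `𝔸_K`; here only the injectivity of `K → K_v` is used.) [folklore] -/
theorem GLn.toAdelic_mem_quotientSubgroup_iff (c : GL (Fin n) (w.adicCompletion K)) :
    GLn.toAdelic n K w c ∈ (AdelicGroupData.gl n K).quotientSubgroup ↔ c = 1 := by
  constructor
  · intro hc
    haveI : (AdelicGroupData.gl n K).center'.Normal :=
      ⟨fun a ha g => by
        rwa [Subgroup.mem_center_iff.1 ((AdelicGroupData.gl n K).center'_le ha) g,
          mul_inv_cancel_right]⟩
    have hc' : GLn.toAdelic n K w c ∈ (((AdelicGroupData.gl n K).center' ⊔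
        (AdelicGroupData.gl n K).arithmeticSubgroup :
          Subgroup (AdelicGroupData.gl n K).Adelic) : Set (AdelicGroupData.gl n K).Adelic) := hc
    rw [Subgroup.normal_mul] at hc'
    obtain ⟨a, ha, _, ⟨γ, rfl⟩, hprod⟩ := hc'
    change a * (AdelicGroupData.gl n K).toAdelic γ = GLn.toAdelic n K w c at hprod
    -- a finite place `v ≠ w`
    haveI := infinite_heightOneSpectrum K
    obtain ⟨v, hvw⟩ := exists_ne w
    -- the `v`-components: `γ = 1`
    have hv : GLn.toLocalAt n K v (a * (AdelicGroupData.gl n K).toAdelic γ) = 1 := by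
      rw [hprod]
      exact GLn.toLocal_ofLocal_of_ne hvw c
    rw [map_mul, (MonoidHom.mem_ker).1 (GLn.center'_le_ker_toLocalAt n K v ha), one_mul] at hv
    have hγ : γ = 1 := by
      refine Matrix.GeneralLinearGroup.ext fun i j => ?_
      apply (algebraMap K (v.adicCompletion K)).injective
      have hij := congrArg (fun g : GL (Fin n) (v.adicCompletion K) =>
        (g : Matrix (Fin n) (Fin n) (v.adicCompletion K)) i j) hv
      simp only [Units.val_one] at hij
      change algebraMap K (v.adicCompletion K) ((Units.val γ : Matrix (Fin n) (Fin n) K) i j) =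
        algebraMap K (v.adicCompletion K) ((1 : Matrix (Fin n) (Fin n) K) i j)
      rw [Matrix.one_apply, apply_ite (algebraMap K (v.adicCompletion K)), map_one,
        map_zero, ← Matrix.one_apply]
      exact hij
    -- hence `ι_w(c) = a` and `c = a_w = 1`
    rw [hγ, map_one, mul_one] at hprod
    have hcw := GLn.toLocal_toAdelic (n := n) (K := K) (v := w) c
    rw [← hprod, (MonoidHom.mem_ker).1 (GLn.center'_le_ker_toLocalAt n K w ha)] at hcw
    exact hcw.symm
  · rintro rfl
    rw [map_one]
    exact one_mem _

/-- **Tube lemma around `ι_w(C)`.** For a compact `C ⊆ GL_n(K_w)` not containing `1` there is an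
open neighbourhood `N` of `1` in `GL_n(𝔸_K)` with `a⁻¹ ι_w(c) b ∉ A_G · GL_n(K)` for all
`a, b ∈ N`, `c ∈ C`: the map `((a, b), c) ↦ a⁻¹ ι_w(c) b` is continuous, `A_G · GL_n(K)` is closed
(`isClosed_quotientSubgroup_gl_holds`) and misses `ι_w(C)` (`GLn.toAdelic_mem_quotientSubgroup_iff`),
so the generalized tube lemma applies to `{(1, 1)} × C`. [folklore] -/
theorem exists_nhds_forall_conj_toAdelic_not_mem {C : Set (GL (Fin n) (w.adicCompletion K))}
    (hC : IsCompact C) (h1 : (1 : GL (Fin n) (w.adicCompletion K)) ∉ C) :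
    ∃ N : Set (AdelicGroupData.gl n K).Adelic, IsOpen N ∧ (1 : (AdelicGroupData.gl n K).Adelic) ∈ N ∧
      ∀ a ∈ N, ∀ b ∈ N, ∀ c ∈ C,
        a⁻¹ * GLn.toAdelic n K w c * b ∉ (AdelicGroupData.gl n K).quotientSubgroup := by
  set Φ : ((AdelicGroupData.gl n K).Adelic × (AdelicGroupData.gl n K).Adelic) ×
      GL (Fin n) (w.adicCompletion K) → (AdelicGroupData.gl n K).Adelic :=
    fun p => p.1.1⁻¹ * GLn.toAdelic n K w p.2 * p.1.2 with hΦ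
  have hΦc : Continuous Φ :=
    ((continuous_fst.comp continuous_fst).inv.mul
      ((GLn.continuous_toAdelic n K w).comp continuous_snd)).mul (continuous_snd.comp continuous_fst)
  set O : Set (((AdelicGroupData.gl n K).Adelic × (AdelicGroupData.gl n K).Adelic) ×
      GL (Fin n) (w.adicCompletion K)) :=
    Φ ⁻¹' (((AdelicGroupData.gl n K).quotientSubgroup : Set (AdelicGroupData.gl n K).Adelic)ᶜ)
    with hO
  have hOo : IsOpen O := (isClosed_quotientSubgroup_gl_holds n K).isOpen_compl.preimage hΦc
  have hsub : ({((1 : (AdelicGroupData.gl n K).Adelic), (1 : (AdelicGroupData.gl n K).Adelic))} :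
      Set ((AdelicGroupData.gl n K).Adelic × (AdelicGroupData.gl n K).Adelic)) ×ˢ C ⊆ O := by
    rintro ⟨p, c⟩ ⟨hp, hc⟩
    rw [Set.mem_singleton_iff] at hp
    subst hp
    simp only [hO, hΦ, Set.mem_preimage, Set.mem_compl_iff, inv_one, one_mul, mul_one, SetLike.mem_coe,
      GLn.toAdelic_mem_quotientSubgroup_iff]
    rintro rfl
    exact h1 hc
  obtain ⟨u, t, hu, -, h1u, hCt, hut⟩ := generalized_tube_lemma isCompact_singleton hC hOo hsub
  have h11 : ((1 : (AdelicGroupData.gl n K).Adelic), (1 : (AdelicGroupData.gl n K).Adelic)) ∈ u :=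
    h1u (Set.mem_singleton _)
  obtain ⟨N₁, N₂, hN₁, hN₂, h1, h2, hprod⟩ := isOpen_prod_iff.1 hu 1 1 h11
  refine ⟨N₁ ∩ N₂, hN₁.inter hN₂, ⟨h1, h2⟩, fun a ha b hb c hc hmem => ?_⟩
  have hO' : ((a, b), c) ∈ O := hut ⟨hprod ⟨ha.1, hb.2⟩, hCt hc⟩
  exact hO' hmem

variable {n w}

/-- `g • [V] = [g V]`: translating the image of `V ⊆ GL_n(𝔸_K)` in the automorphic quotient.
[folklore] -/
theorem smul_image_toAutomorphicQuotient (g : (AdelicGroupData.gl n K).Adelic)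
    (V : Set (AdelicGroupData.gl n K).Adelic) :
    g • ((AdelicGroupData.gl n K).toAutomorphicQuotient '' V) =
      (AdelicGroupData.gl n K).toAutomorphicQuotient '' ((g * ·) '' V) := by
  rw [← Set.image_smul, Set.image_image, Set.image_image]
  rfl

variable (n w) in
/-- **A separated open set in the automorphic quotient.** For subgroups `U₂ ≤ U₁` of `GL_n(K_w)`,
`U₁` compact and `U₂` open, there is a non-empty open `S ⊆ GL_n(𝔸_K) ⧸ A_G GL_n(K)` which is
stable under `ι_w(U₂)` and disjoint from `ι_w(c) S` for every `c ∈ U₁ ∖ U₂`: with `N` a tube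
neighbourhood for the compact `C = U₁ ∖ U₂ ∌ 1` (`exists_nhds_forall_conj_toAdelic_not_mem`), take
`S = [ι_w(U₂) N]`; a coincidence `ι_w(c u) m ≡ ι_w(u') m'` would put `m'⁻¹ ι_w(u'⁻¹ c u)⁻¹ …` — precisely
`m⁻¹ ι_w(u⁻¹ c⁻¹ u') m'`, `u⁻¹ c⁻¹ u' ∈ U₁ ∖ U₂` — in `A_G GL_n(K)`. [folklore] -/
theorem exists_separated_open {U₁ U₂ : Subgroup (GL (Fin n) (w.adicCompletion K))} (h21 : U₂ ≤ U₁)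
    (hU₁ : IsCompact (U₁ : Set (GL (Fin n) (w.adicCompletion K))))
    (hU₂ : IsOpen (U₂ : Set (GL (Fin n) (w.adicCompletion K)))) :
    ∃ S : Set (AdelicGroupData.gl n K).automorphicQuotient, IsOpen S ∧ S.Nonempty ∧
      (∀ u ∈ U₂, GLn.toAdelic n K w u • S = S) ∧
      (∀ c ∈ U₁, c ∉ U₂ → GLn.toAdelic n K w c • S ∩ S = ∅) := by
  -- the compact `C = U₁ ∖ U₂` and the tube neighbourhood `N`
  set C : Set (GL (Fin n) (w.adicCompletion K)) := (U₁ : Set _) ∩ (U₂ : Set _)ᶜ with hC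
  have hCc : IsCompact C := hU₁.inter_right hU₂.isClosed_compl
  have h1C : (1 : GL (Fin n) (w.adicCompletion K)) ∉ C := fun h => h.2 (one_mem U₂)
  obtain ⟨N, hNo, h1N, hN⟩ := exists_nhds_forall_conj_toAdelic_not_mem n w hCc h1C
  -- `V = ι_w(U₂) N` and its image `S`
  set A : Subgroup (AdelicGroupData.gl n K).Adelic := U₂.map (GLn.toAdelic n K w) with hA
  set V : Set (AdelicGroupData.gl n K).Adelic := (A : Set (AdelicGroupData.gl n K).Adelic) * N with hV
  have hVo : IsOpen V := hNo.mul_left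
  refine ⟨(AdelicGroupData.gl n K).toAutomorphicQuotient '' V, QuotientGroup.isOpenMap_coe V hVo,
    ⟨(AdelicGroupData.gl n K).toAutomorphicQuotient 1, 1, Set.mem_mul.2 ⟨1, one_mem A, 1, h1N, mul_one _⟩,
      rfl⟩, fun u hu => ?_, fun c hc1 hc2 => ?_⟩
  · -- stability under `ι_w(U₂)`
    rw [smul_image_toAutomorphicQuotient]
    congr 1
    have hmem : GLn.toAdelic n K w u ∈ A := Subgroup.mem_map_of_mem _ hu
    ext p
    constructor
    · rintro ⟨q, hq, rfl⟩
      obtain ⟨a, ha, m, hm, rfl⟩ := Set.mem_mul.1 hq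
      refine Set.mem_mul.2 ⟨GLn.toAdelic n K w u * a, A.mul_mem hmem ha, m, hm, ?_⟩
      exact (mul_assoc _ _ _)
    · intro hp
      obtain ⟨a, ha, m, hm, rfl⟩ := Set.mem_mul.1 hp
      refine ⟨(GLn.toAdelic n K w u)⁻¹ * a * m,
        Set.mem_mul.2 ⟨_, A.mul_mem (A.inv_mem hmem) ha, m, hm, rfl⟩, ?_⟩
      change GLn.toAdelic n K w u * ((GLn.toAdelic n K w u)⁻¹ * a * m) = a * m
      group
  · -- disjointness of the translates by `ι_w(c)`, `c ∈ U₁ ∖ U₂`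
    rw [smul_image_toAutomorphicQuotient, Set.eq_empty_iff_forall_notMem]
    rintro x ⟨⟨q, ⟨p, hp, rfl⟩, rfl⟩, ⟨p', hp', heq⟩⟩
    obtain ⟨_, ⟨u, hu, rfl⟩, m, hm, rfl⟩ := Set.mem_mul.1 hp
    obtain ⟨_, ⟨u', hu', rfl⟩, m', hm', rfl⟩ := Set.mem_mul.1 hp'
    have hrel := QuotientGroup.eq.1 heq.symm
    have hid : (GLn.toAdelic n K w c * (GLn.toAdelic n K w u * m))⁻¹ * (GLn.toAdelic n K w u' * m') =
        m⁻¹ * GLn.toAdelic n K w (u⁻¹ * c⁻¹ * u') * m' := by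
      simp only [map_mul, map_inv]
      group
    rw [hid] at hrel
    refine hN m hm m' hm' (u⁻¹ * c⁻¹ * u') ⟨?_, fun h => hc2 ?_⟩ hrel
    · exact U₁.mul_mem (U₁.mul_mem (U₁.inv_mem (h21 hu)) (U₁.inv_mem hc1)) (h21 hu')
    · have h' : c = u' * (u⁻¹ * c⁻¹ * u')⁻¹ * u⁻¹ := by group
      rw [h']
      exact U₂.mul_mem (U₂.mul_mem hu' (U₂.inv_mem h)) (U₂.inv_mem hu)

end Separation

/-! ### 3. The indicator vector `z = 1_S` and `Σ_γ ξ(γ̃) R(ι_w γ̃) z ≠ 0` over `GL₂` -/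

section Vector

variable (F : Type) [Field F] [NumberField F] (w : HeightOneSpectrum (𝓞 F))
  {μ : Measure (AdelicGroupData.gl 2 F).automorphicQuotient}
  [(AdelicGroupData.gl 2 F).IsAutomorphicMeasure μ]

/-- `R(g) 1_S = 1_{g S}` in `L²` of the automorphic quotient (`(R g f)(x) = f(g⁻¹ x)`, Mathlib
`DomMulAct.mk_smul_indicatorConstLp`). [folklore] -/
theorem rightRegular_indicatorConstLp (g : (AdelicGroupData.gl 2 F).Adelic)
    {S : Set (AdelicGroupData.gl 2 F).automorphicQuotient} (hS : MeasurableSet S) (hμS : μ S ≠ ⊤)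
    (hS' : MeasurableSet (g • S)) (hμS' : μ (g • S) ≠ ⊤) :
    (AdelicGroupData.gl 2 F).rightRegular μ g (indicatorConstLp 2 hS hμS (1 : ℂ)) =
      indicatorConstLp 2 hS' hμS' (1 : ℂ) := by
  rw [AdelicGroupData.rightRegular_apply, DomMulAct.mk_smul_indicatorConstLp]
  congr 1
  ext x
  rw [Set.mem_preimage, Set.mem_smul_set_iff_inv_smul_mem]

/-- `γ = 1 · U` iff the chosen representative `γ̃` lies in `U`. [folklore] -/
theorem out_mem_iff_eq_one {G : Type*} [Group G] (U : Subgroup G) (γ : G ⧸ U) :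
    γ.out ∈ U ↔ γ = ((1 : G) : G ⧸ U) := by
  constructor
  · intro h
    rw [← QuotientGroup.out_eq' γ]
    exact QuotientGroup.eq.2 (by rwa [mul_one, inv_mem_iff])
  · intro h
    have h' := QuotientGroup.eq.1 ((QuotientGroup.out_eq' γ).trans h)
    rwa [mul_one, inv_mem_iff] at h'

open GL2LocalSupercuspForm in
/-- **The test vector.** With `ξ` the local supercusp form of `GL2LocalSupercuspForm` at `w`
(supported in `U₁`, right `U₂`-invariant, `ξ(1) ≠ 0`; `U_m` the principal congruence subgroups)
and `T` a finite set of cosets of `U₂` covering `supp ξ`: the indicator `z = 1_S ∈ L²` of the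
separated open set `S` of `exists_separated_open` is fixed by `ι_w(U₂)` and
`h = Σ_{γ ∈ T} ξ(γ̃) R(ι_w γ̃) z ≠ 0`, because `⟨z, h⟩ = Σ_γ ξ(γ̃) μ(S ∩ ι_w(γ̃) S) = ξ(1) μ(S)`
(only the coset `γ = U₂` meets: `ξ(γ̃) ≠ 0` forces `γ̃ ∈ U₁`, and `ι_w(γ̃) S ∩ S = ∅` for
`γ̃ ∈ U₁ ∖ U₂`) and `μ(S) > 0` (an automorphic measure charges open sets).
[cite: Gelbart1975, §10 pp. 152–153] -/
theorem exists_fixedVector_sum_ne_zero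
    {T : Finset (GL (Fin 2) (w.adicCompletion F) ⧸ localCongruenceSubgroup 2 F w 2)}
    (hT : tsupport (form F w) ⊆ ⋃ γ ∈ T,
      {x | (x : GL (Fin 2) (w.adicCompletion F) ⧸ localCongruenceSubgroup 2 F w 2) = γ}) :
    ∃ y : (⊤ : ContRepresentation.ClosedSubrep ((AdelicGroupData.gl 2 F).rightRegular μ)).toSubmodule,
      y ∈ (⊤ : ContRepresentation.ClosedSubrep ((AdelicGroupData.gl 2 F).rightRegular μ)).fixedVectors
          ((localCongruenceSubgroup 2 F w 2).map (GLn.toAdelic 2 F w)) ∧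
        ∑ γ ∈ T, form F w γ.out •
          (⊤ : ContRepresentation.ClosedSubrep ((AdelicGroupData.gl 2 F).rightRegular μ)).toContRep
            (GLn.toAdelic 2 F w γ.out) y ≠ 0 := by
  classical
  have h21 : localCongruenceSubgroup 2 F w 2 ≤ localCongruenceSubgroup 2 F w 1 :=
    localCongruenceSubgroup_antitone 2 F w one_le_two
  obtain ⟨S, hSo, hSne, hSfix, hSdisj⟩ := exists_separated_open 2 w h21
    (isCompact_localCongruenceSubgroup 2 F w 1) (isOpen_localCongruenceSubgroup 2 F w 2)
  have hS : MeasurableSet S := hSo.measurableSet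
  have hμS : μ S ≠ ⊤ := measure_ne_top μ S
  have hSg : ∀ g : (AdelicGroupData.gl 2 F).Adelic, MeasurableSet (g • S) := fun g =>
    (hSo.smul g).measurableSet
  have hμSg : ∀ g : (AdelicGroupData.gl 2 F).Adelic, μ (g • S) ≠ ⊤ := fun g => measure_ne_top μ _
  set z : (AdelicGroupData.gl 2 F).L2 μ := indicatorConstLp 2 hS hμS (1 : ℂ) with hz
  refine ⟨⟨z, Submodule.mem_top⟩, ?_, fun h0 => ?_⟩
  · -- `z` is fixed by `ι_w(U₂)`: `ι_w(u) S = S`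
    rw [ContRepresentation.ClosedSubrep.mem_fixedVectors]
    rintro _ ⟨u, hu, rfl⟩
    apply Subtype.ext
    rw [ContRepresentation.ClosedSubrep.coe_toContRep_apply]
    change (AdelicGroupData.gl 2 F).rightRegular μ (GLn.toAdelic 2 F w u) z = z
    rw [hz, rightRegular_indicatorConstLp F _ hS hμS (hSg _) (hμSg _)]
    congr 1
    exact hSfix u hu
  · -- `⟨z, h⟩ = ξ(1) μ(S) ≠ 0`
    have h0' := congrArg (fun y : (⊤ : ContRepresentation.ClosedSubrep
        ((AdelicGroupData.gl 2 F).rightRegular μ)).toSubmodule =>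
      ⟪z, (y : (AdelicGroupData.gl 2 F).L2 μ)⟫_ℂ) h0
    simp only [Submodule.coe_sum, Submodule.coe_smul, Submodule.coe_zero, inner_zero_right, inner_sum,
      inner_smul_right, ContRepresentation.ClosedSubrep.coe_toContRep_apply] at h0'
    have hinner : ∀ γ : GL (Fin 2) (w.adicCompletion F) ⧸ localCongruenceSubgroup 2 F w 2,
        ⟪z, (AdelicGroupData.gl 2 F).rightRegular μ (GLn.toAdelic 2 F w γ.out) z⟫_ℂ =
          (μ.real (S ∩ GLn.toAdelic 2 F w γ.out • S) : ℂ) := by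
      intro γ
      rw [hz, rightRegular_indicatorConstLp F _ hS hμS (hSg _) (hμSg _),
        L2.inner_indicatorConstLp_indicatorConstLp]
      simp
    simp_rw [hinner] at h0'
    -- only the identity coset contributes
    have h1T : (((1 : GL (Fin 2) (w.adicCompletion F))) :
        GL (Fin 2) (w.adicCompletion F) ⧸ localCongruenceSubgroup 2 F w 2) ∈ T := by
      have h1 : (1 : GL (Fin 2) (w.adicCompletion F)) ∈ tsupport (form F w) :=
        subset_tsupport _ (Function.mem_support.2 form_one_ne_zero)
      obtain ⟨γ, hγ⟩ := Set.mem_iUnion.1 (hT h1)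
      obtain ⟨hγT, hγ1⟩ := Set.mem_iUnion.1 hγ
      rw [Set.mem_setOf_eq] at hγ1
      rwa [hγ1]
    have hsum : ∑ γ ∈ T, form F w γ.out * (μ.real (S ∩ GLn.toAdelic 2 F w γ.out • S) : ℂ) =
        form F w 1 * (μ.real S : ℂ) := by
      rw [Finset.sum_eq_single_of_mem _ h1T]
      · have hγ₁ : (((1 : GL (Fin 2) (w.adicCompletion F)) :
            GL (Fin 2) (w.adicCompletion F) ⧸ localCongruenceSubgroup 2 F w 2).out) ∈
              localCongruenceSubgroup 2 F w 2 := (out_mem_iff_eq_one _ _).2 rfl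
        rw [hSfix _ hγ₁, Set.inter_self, ← form_mul_of_mem 1 hγ₁, one_mul]
      · intro γ _ hne
        by_cases hγ0 : form F w γ.out = 0
        · rw [hγ0, zero_mul]
        · have hU2 : γ.out ∉ localCongruenceSubgroup 2 F w 2 := fun h =>
            hne ((out_mem_iff_eq_one _ _).1 h)
          rw [Set.inter_comm, hSdisj _ (mem_of_form_ne_zero hγ0) hU2, measureReal_empty,
            Complex.ofReal_zero, mul_zero]
    rw [hsum] at h0'
    have hpos : 0 < μ.real S :=
      ENNReal.toReal_pos (hSo.measure_pos μ hSne).ne' hμS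
    rcases mul_eq_zero.1 h0' with h | h
    · exact form_one_ne_zero h
    · exact hpos.ne' (by exact_mod_cast h)

end Vector

/-! ### 4. `L²_cusp(GL₂) ≠ 0` and the discharge of `nonempty_cuspidalAutomorphicRepData_two` -/

section Assembly

attribute [local instance] adelicBorel borelSpace_adelic locallyCompactSpace_adelic
  secondCountableTopology_gl_adelic

open GL2LocalSupercuspForm in
/-- **`L²_cusp(GL₂(F) A_G \ GL₂(𝔸_F)) ≠ 0` for every number field `F`** (Jacquet–Langlands (1970),
§16, p. 503; Gelbart (1975), §10, (10.13)–(10.16); Arthur–Clozel (1989), Ch. 1, Lemma 2.4).  Take a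
finite place `w`, the supercusp form `ξ` of `GL2LocalSupercuspForm` at `w`, the test vector
`z = 1_S` of `exists_fixedVector_sum_ne_zero` and a small weight `θ` (`exists_symmetric_weight`):
`R(Φ_{θ,ξ}) z ≠ 0` (`exists_nhds_integratedOperator_localTestFunction_ne_zero_of_sum_ne_zero`) and
`R(Φ_{θ,ξ}) z ∈ L²_cusp` (`integratedOperator_rightRegular_mem_cuspidalSubspace`: `Φ_{θ,ξ}` has
vanishing unipotent averages, `integral_localTestFunction_comp_glUnipotent_eq_zero` with
`integral_form_unipotentOfBlock_eq_zero`). [cite: JacquetLanglands1970, §16 p. 503] -/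
theorem cuspidalSubspace_two_ne_bot (F : Type) [Field F] [NumberField F]
    (μ : Measure (AdelicGroupData.gl 2 F).automorphicQuotient)
    [(AdelicGroupData.gl 2 F).IsAutomorphicMeasure μ] :
    cuspidalSubspace 2 F μ ≠ ⊥ := by
  classical
  -- a finite place `w`
  haveI := infinite_heightOneSpectrum F
  obtain ⟨w⟩ : Nonempty (HeightOneSpectrum (𝓞 F)) := inferInstance
  -- the local supercusp form at `w`, cosets of `U₂` covering its support, the test vector
  have hU : IsCompact ((localCongruenceSubgroup 2 F w 2 : Subgroup (GL (Fin 2) (w.adicCompletion F))) :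
        Set (GL (Fin 2) (w.adicCompletion F))) ∧
      IsOpen ((localCongruenceSubgroup 2 F w 2 : Subgroup (GL (Fin 2) (w.adicCompletion F))) :
        Set (GL (Fin 2) (w.adicCompletion F))) :=
    ⟨isCompact_localCongruenceSubgroup 2 F w 2, isOpen_localCongruenceSubgroup 2 F w 2⟩
  obtain ⟨T, hT⟩ := exists_finset_tsupport_subset_biUnion_coset (localCongruenceSubgroup 2 F w 2) hU.2
    (hasCompactSupport_form (K := F) (v := w))
  obtain ⟨y, hy, hmain⟩ := exists_fixedVector_sum_ne_zero F w (μ := μ) hT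
  obtain ⟨N, hN, hne⟩ := exists_nhds_integratedOperator_localTestFunction_ne_zero_of_sum_ne_zero ⊤ hU
    continuous_form hasCompactSupport_form (fun g k hk => form_mul_of_mem g hk) hT hy hmain
  -- a small weight `θ`
  obtain ⟨θ, hθ, hθs, hθ0, -, hθ1, hθN⟩ := exists_symmetric_weight hN
  have hne' := hne θ hθ hθs hθ0 hθ1 hθN
  -- `Φ_{θ,ξ}` has vanishing unipotent averages along `P_1` (the only proper standard parabolic)
  have hH : ∀ k, 0 < k → k < 2 →
      ∀ (ν : Measure (blockNilpotent 2 k (AdeleRing (𝓞 F) F))) [ν.IsAddHaarMeasure]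
        (p r : (AdelicGroupData.gl 2 F).Adelic),
        ∫ Y, (localTestFunctionCc hθ hθs (continuous_form (K := F) (v := w))
          (hasCompactSupport_form (K := F) (v := w)))
            (p * glUnipotent 2 k F (Multiplicative.ofAdd Y) * r) ∂ν = 0 := by
    intro k hk hk2 ν _ p r
    obtain rfl : k = 1 := by omega
    letI : MeasurableSpace (blockNilpotent 2 1 (w.adicCompletion F)) := borel _
    haveI : BorelSpace (blockNilpotent 2 1 (w.adicCompletion F)) := ⟨rfl⟩
    haveI : T2Space (Matrix (Fin 2) (Fin 2) (w.adicCompletion F)) :=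
      inferInstanceAs (T2Space (Fin 2 → Fin 2 → w.adicCompletion F))
    haveI : LocallyCompactSpace (Matrix (Fin 2) (Fin 2) (w.adicCompletion F)) :=
      inferInstanceAs (LocallyCompactSpace (Fin 2 → Fin 2 → w.adicCompletion F))
    haveI : LocallyCompactSpace (blockNilpotent 2 1 (w.adicCompletion F)) :=
      (isClosed_coe_blockNilpotent_local (n := 2) (k := 1)
        (F := w.adicCompletion F)).isClosedEmbedding_subtypeVal.locallyCompactSpace
    set αw : Measure (blockNilpotent 2 1 (w.adicCompletion F)) := Measure.addHaar with hαw
    exact integral_localTestFunction_comp_glUnipotent_eq_zero hθ hθs continuous_form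
      hasCompactSupport_form αw (integral_form_unipotentOfBlock_eq_zero αw) ν p r
  -- `R(Φ_{θ,ξ}) z ∈ L²_cusp` and `≠ 0`
  haveI : (adelicHaar 2 F).IsInvInvariant := adelicHaar_isInvInvariant 2 F
  have hmem := integratedOperator_rightRegular_mem_cuspidalSubspace (μ := μ) hH (adelicHaar 2 F)
    ((y : (⊤ : ContRepresentation.ClosedSubrep ((AdelicGroupData.gl 2 F).rightRegular μ)).toSubmodule) :
      (AdelicGroupData.gl 2 F).L2 μ)
  intro hbot
  rw [hbot, ContRepresentation.ClosedSubrep.mem_bot] at hmem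
  exact hne' hmem

/-- **Cuspidal automorphic representations of `GL₂(𝔸_F)` exist for every number field `F`**:
discharge of the named fact `nonempty_cuspidalAutomorphicRepData_two` (Gelbart (1975), Thm. 7.11;
Jacquet–Langlands (1970), §12 and §16).  An automorphic measure exists
(`AdelicGroupData.exists_isAutomorphicMeasure_gl_holds`), `L²_cusp ≠ 0`
(`cuspidalSubspace_two_ne_bot`), and a non-zero cuspidal subspace yields a datum
(`CuspidalAutomorphicRepData.ofCuspidalSubspaceNeBot`, Borel–Jacquet 4.6 with the discreteness of the
cuspidal spectrum). [cite: Gelbart1975, Thm. 7.11] -/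
theorem nonempty_cuspidalAutomorphicRepData_two_holds : nonempty_cuspidalAutomorphicRepData_two := by
  intro F _ _ hF
  obtain ⟨μ, hμ⟩ := AdelicGroupData.exists_isAutomorphicMeasure_gl_holds 2 F
  haveI := hμ
  exact ⟨CuspidalAutomorphicRepData.ofCuspidalSubspaceNeBot hF (cuspidalSubspace_two_ne_bot F μ)⟩

end Assembly

end Literature.NumberTheory.Automorphic
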